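/-
Copyright: the b2b-balaban T⁴-continuum CRUX team, row NE7b OWNER lineage `t4-ne7b-p1` (gen 134). Project licence.
-/
import Summits.QuantumFields.BalabanUV.T4Continuum.Spine.NE7b.SupPolymerLocalExpansion

/-!
# THE RESUMMED ACTIVITY IS SMALL LIKE `(Cε)^{#Y}` — LINEARLY IN `ε`, NO SQUARE ROOT: (350) bounded the resummed activity of the polymer-local gas
# by `(√ε·e^{2√ε})^{#Y}`, paying half of the smallness for the support.  Weighting the cover count by `t^{Σ#X − #Y} ≥ 1` instead (`t ≥ 1`):
#   `|(⋃_*M)(Y)| ≤ (e^{2εt}∕t)^{#Y}`  whenever  `|M(𝒜)| ≤ ∏_{X∈𝒜}ε^{#X}`,  `(Δ+1)²·εt ≤ 1∕2`,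
# and with the largest admissible `t = 1∕(2(Δ+1)²ε)`:  `|(⋃_*M)(Y)| ≤ (2e(Δ+1)²·ε)^{#Y}` — the polymer-local input class passes to (287)'s format with a
# letter LINEAR in `ε` (constant `2e(Δ+1)²`), so the sup letter of the class does NOT lose a power per step (SCOPING-d6 (L1) repaired at its
# source); the convergent-gas conclusions of (353) §2 re-instantiated with this letter (row NE7b, node U5c; (350)'s `sum_prod_le_exp_sum` ∕
# `sum_pow_le_two_mul_card` + (352) BY NAME; [folklore])

Cell `pub-balaban`, sub-cell `t4`, spine estimate NE7b (`T4WeightBudget.RelWeightBound`; the cell's OWN estimate — NOT PRINTED in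
[Bałaban 1983–89], NOT PROVED).  Crux-route work under `Spine/NE7b/` by the row OWNER (`t4-ne7b-p1` gen 134, file (357)) under FREEZE
(0)'s crux-prover clause, on `g134/records/SCOPING-d6-iteration.md` (L1); NOTHING of Bałaban's is named as a Lean object, valued or asserted; no
`T4Continuum/Support` leaf typed; no `def`, no notation; zero `sorry`.  Imports (BY NAME): the OWNER's (353) `…SupPolymerLocalExpansion`
(`setPertZ_eq_resummedGas`, `pushforward_eq_zero_of_not_rconn`) and through it (350) (`card_le_sum_card_of_biUnion_eq`, `sum_prod_le_exp_sum`,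
`sum_pow_le_two_mul_card`), (349) (`image_biUnion_subset_rconn`), (352) (`ne_zero`, `exp_polymerLogZ`, `norm_polymerLogZ_le`); the tree's
`pushforwardActivity_apply`, `rconnSubsets`, `mem_rconnSubsets`, `IsRConnected`, `pertZ`, `cellActivity`, `polymerLogZ`.

WHAT IS PROVED ([folklore]):
* §1 `pow_totalsize_le_weighted` (`t ≥ 1`, `⋃𝒜 = Y` ⟹ `∏_{X∈𝒜}ε^{#X} ≤ t^{−#Y}·∏_{X∈𝒜}(εt)^{#X}`), THE END **`abs_pushforwardActivity_le_weighted`**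
  (`|(⋃_*M)(Y)| ≤ (e^{2εt}∕t)^{#Y}` under `(Δ+1)²εt ≤ 1∕2`) and **`abs_pushforwardActivity_le_linear`** (`0 < ε`, `2(Δ+1)²ε ≤ 1` ⟹
  `|(⋃_*M)(Y)| ≤ (2e(Δ+1)²ε)^{#Y}`);
* §2 the convergent gas with the LINEAR letter (abstract measure level, `ε₁ := 2e(Δ+1)²ε`, smallness `e·ε₁·(Δ+1)² ≤ 1∕2`): **`setPertZ_ne_zero_linear`**,
  **`exp_setLogZ_linear`**, **`norm_setLogZ_le_linear`** (`‖log Ξ‖ ≤ #(⋃𝒳)(Δ+1)2e·ε₁`); §3 toy.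

HONEST (what this is NOT).  Combinatorics; the constant `2e(Δ+1)²` is not optimised; the weight shift of (356) (L2) is untouched (no rescaling:
NC-NE7b-α UNRULED); scalar skeleton ((A3)); nothing of Bałaban's asserted.  BY-NAME EFFECT ON THE WALL: NONE.  NE7b NOT PRINTED ∕ NOT PROVED; spine
PROVED 0∕9; rung (B)+1 — the programme's measures remain FINITE-torus statements; NOT the mass gap, NOT Clay.  HONEST DEPENDENCY: continuum YM on
T⁴ ⇐ BetaPertH ∧ nine spine estimates (0∕9 proved); BetaPertH ⇐ (D1) ∧ (D4) ∧ CAP+tail; G-an2-4 gates asym, D1 and NE2∕3∕4.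
-/

set_option autoImplicit false

noncomputable section

namespace Summit.QuantumFields.BalabanUV.T4Continuum.NE7b.SupPolymerLocalSmallnessLinear

open MeasureTheory ProbabilityTheory Finset Real
open scoped BigOperators
open Literature.Probability.LatticeModels
open SupPolymerLocalSmallness (card_le_sum_card_of_biUnion_eq sum_prod_le_exp_sum sum_pow_le_two_mul_card)
open SupPolymerLocalResummation (image_biUnion_subset_rconn)
open SupPolymerLocalExpansion (setPertZ_eq_resummedGas pushforward_eq_zero_of_not_rconn)

variable {V : Type*} [DecidableEq V] {R : V → V → Prop} [DecidableRel R] {nbr : V → Finset V} {Δ : ℕ}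

/-! ## §1. Weighted cover counting: the linear letter -/

omit [DecidableRel R] in
/-- **The support is paid by the weight, not by the smallness**: `0 ≤ ε`, `1 ≤ t`, `⋃𝒜 = Y` ⟹ `∏_{X∈𝒜}ε^{#X} ≤ (1∕t)^{#Y}·∏_{X∈𝒜}(εt)^{#X}`
(since `Σ_{X∈𝒜}#X ≥ #Y`). [folklore] -/
theorem pow_totalsize_le_weighted {ε t : ℝ} (hε : 0 ≤ ε) (ht : 1 ≤ t) {𝒜 : Finset (Finset V)} {Y : Finset V} (hU : 𝒜.biUnion id = Y) :
    ∏ X ∈ 𝒜, ε ^ X.card ≤ (1 / t) ^ Y.card * ∏ X ∈ 𝒜, (ε * t) ^ X.card := by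
  have ht0 : 0 < t := lt_of_lt_of_le one_pos ht
  have hS : Y.card ≤ ∑ X ∈ 𝒜, X.card := card_le_sum_card_of_biUnion_eq hU
  have e1 : ∏ X ∈ 𝒜, (ε * t) ^ X.card = t ^ (∑ X ∈ 𝒜, X.card) * ∏ X ∈ 𝒜, ε ^ X.card := by
    rw [← prod_pow_eq_pow_sum, ← prod_mul_distrib]
    exact prod_congr rfl fun X _ => by rw [mul_pow, mul_comm]
  rw [e1, ← mul_assoc]
  have hge : 1 ≤ (1 / t) ^ Y.card * t ^ (∑ X ∈ 𝒜, X.card) := by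
    obtain ⟨k, hk⟩ := Nat.exists_eq_add_of_le hS
    rw [hk, pow_add, ← mul_assoc, ← mul_pow, one_div, inv_mul_cancel₀ ht0.ne', one_pow, one_mul]
    exact one_le_pow₀ ht
  exact le_mul_of_one_le_left (prod_nonneg fun X _ => pow_nonneg hε _) hge

omit [DecidableRel R] in
/-- **THE WEIGHTED COVER-COUNTING BOUND.**  `R` symmetric, decidable, with `≤ Δ` neighbours; `𝒳` a finite family of `R`-connected cell sets;
`|M(𝒜)| ≤ ∏_{X∈𝒜}ε^{#X}` for `𝒜 ⊆ 𝒳` (`0 ≤ ε`); `1 ≤ t` with `(Δ+1)²·εt ≤ 1∕2` ⟹ for every cell set `Y`: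
`|(⋃_*M)(Y)| ≤ (e^{2εt}∕t)^{#Y}`. [folklore] -/
theorem abs_pushforwardActivity_le_weighted (hR : ∀ x y, R x y → R y x) (hΔ : ∀ x, (nbr x).card ≤ Δ) (hnbr : ∀ x y, R x y → y ∈ nbr x)
    (𝒳 : Finset (Finset V)) (hconn : ∀ X ∈ 𝒳, IsRConnected R X) {M : Finset (Finset V) → ℂ} {ε t : ℝ} (hε : 0 ≤ ε) (ht : 1 ≤ t)
    (hM : ∀ 𝒜, 𝒜 ⊆ 𝒳 → ‖M 𝒜‖ ≤ ∏ X ∈ 𝒜, ε ^ X.card) (hsmall : ((Δ : ℝ) + 1) ^ 2 * (ε * t) ≤ 1 / 2) (Y : Finset V) :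
    ‖pushforwardActivity (fun 𝒜 : Finset (Finset V) => 𝒜.biUnion id) M (rconnSubsets (Touches R) 𝒳) Y‖ ≤
      (Real.exp (2 * (ε * t)) / t) ^ Y.card := by
  have ht0 : 0 < t := lt_of_lt_of_le one_pos ht
  have hεt : 0 ≤ ε * t := mul_nonneg hε ht0.le
  have hw0 : 0 ≤ (1 / t) ^ Y.card := pow_nonneg (by positivity) _
  set 𝒳Y := 𝒳.filter (fun X => X ⊆ Y) with h𝒳Y
  have hsub : (rconnSubsets (Touches R) 𝒳).filter (fun 𝒜 => 𝒜.biUnion id = Y) ⊆ 𝒳Y.powerset := fun 𝒜 h𝒜 => by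
    obtain ⟨h𝒜P, hU⟩ := mem_filter.1 h𝒜
    have h𝒜𝒳 := (mem_rconnSubsets.1 h𝒜P).1
    refine mem_powerset.2 fun X hX => mem_filter.2 ⟨h𝒜𝒳 hX, ?_⟩
    rw [← hU]
    exact subset_biUnion_of_mem id hX
  rw [pushforwardActivity_apply]
  calc ‖∑ 𝒜 ∈ (rconnSubsets (Touches R) 𝒳).filter (fun 𝒜 => 𝒜.biUnion id = Y), M 𝒜‖
      ≤ ∑ 𝒜 ∈ (rconnSubsets (Touches R) 𝒳).filter (fun 𝒜 => 𝒜.biUnion id = Y), ‖M 𝒜‖ := norm_sum_le _ _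
    _ ≤ ∑ 𝒜 ∈ (rconnSubsets (Touches R) 𝒳).filter (fun 𝒜 => 𝒜.biUnion id = Y), (1 / t) ^ Y.card * ∏ X ∈ 𝒜, (ε * t) ^ X.card := by
        refine sum_le_sum fun 𝒜 h𝒜 => ?_
        obtain ⟨h𝒜P, hU⟩ := mem_filter.1 h𝒜
        exact (hM 𝒜 (mem_rconnSubsets.1 h𝒜P).1).trans (pow_totalsize_le_weighted hε ht hU)
    _ ≤ ∑ 𝒜 ∈ 𝒳Y.powerset, (1 / t) ^ Y.card * ∏ X ∈ 𝒜, (ε * t) ^ X.card :=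
        sum_le_sum_of_subset_of_nonneg hsub fun 𝒜 _ _ => mul_nonneg hw0 (prod_nonneg fun X _ => pow_nonneg hεt _)
    _ = (1 / t) ^ Y.card * ∑ 𝒜 ∈ 𝒳Y.powerset, ∏ X ∈ 𝒜, (ε * t) ^ X.card := by rw [mul_sum]
    _ ≤ (1 / t) ^ Y.card * Real.exp (∑ X ∈ 𝒳Y, (ε * t) ^ X.card) :=
        mul_le_mul_of_nonneg_left (sum_prod_le_exp_sum 𝒳Y fun X _ => pow_nonneg hεt _) hw0
    _ ≤ (1 / t) ^ Y.card * Real.exp (2 * (ε * t) * Y.card) :=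
        mul_le_mul_of_nonneg_left (Real.exp_le_exp.2 (sum_pow_le_two_mul_card hR hΔ hnbr hεt hsmall 𝒳 hconn Y)) hw0
    _ = (Real.exp (2 * (ε * t)) / t) ^ Y.card := by
        conv_rhs => rw [div_pow, ← Real.exp_nat_mul]
        rw [one_div, inv_pow, inv_mul_eq_div]
        congr 2
        ring

omit [DecidableRel R] in
/-- **THE LINEAR LETTER.**  With the largest admissible weight `t = 1∕(2(Δ+1)²ε)`: `0 < ε`, `2(Δ+1)²ε ≤ 1` ⟹ for every cell set `Y`,
`|(⋃_*M)(Y)| ≤ (2e(Δ+1)²·ε)^{#Y}` — the resummed activity of the polymer-local gas is small LINEARLY in `ε` per cell. [folklore] -/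
theorem abs_pushforwardActivity_le_linear (hR : ∀ x y, R x y → R y x) (hΔ : ∀ x, (nbr x).card ≤ Δ) (hnbr : ∀ x y, R x y → y ∈ nbr x)
    (𝒳 : Finset (Finset V)) (hconn : ∀ X ∈ 𝒳, IsRConnected R X) {M : Finset (Finset V) → ℂ} {ε : ℝ} (hε : 0 < ε)
    (hsmall : 2 * ((Δ : ℝ) + 1) ^ 2 * ε ≤ 1) (hM : ∀ 𝒜, 𝒜 ⊆ 𝒳 → ‖M 𝒜‖ ≤ ∏ X ∈ 𝒜, ε ^ X.card) (Y : Finset V) :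
    ‖pushforwardActivity (fun 𝒜 : Finset (Finset V) => 𝒜.biUnion id) M (rconnSubsets (Touches R) 𝒳) Y‖ ≤
      (2 * Real.exp 1 * ((Δ : ℝ) + 1) ^ 2 * ε) ^ Y.card := by
  have hD : 0 < ((Δ : ℝ) + 1) ^ 2 := by positivity
  have hD1 : 1 ≤ ((Δ : ℝ) + 1) ^ 2 := by
    have : (0 : ℝ) ≤ Δ := Nat.cast_nonneg Δ
    nlinarith
  set t : ℝ := 1 / (2 * ((Δ : ℝ) + 1) ^ 2 * ε) with htdef
  have hden : 0 < 2 * ((Δ : ℝ) + 1) ^ 2 * ε := by positivity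
  have ht : 1 ≤ t := by rw [htdef, le_div_iff₀ hden, one_mul]; exact hsmall
  have hεt : ε * t = 1 / (2 * ((Δ : ℝ) + 1) ^ 2) := by
    rw [htdef]; field_simp
  have hsmall' : ((Δ : ℝ) + 1) ^ 2 * (ε * t) ≤ 1 / 2 := by
    rw [hεt]; field_simp; exact le_refl _
  refine (abs_pushforwardActivity_le_weighted hR hΔ hnbr 𝒳 hconn hε.le ht hM hsmall' Y).trans (pow_le_pow_left₀ (by positivity) ?_ _)
  -- `e^{2εt}/t = e^{1/(Δ+1)²}·2(Δ+1)²ε ≤ e·2(Δ+1)²ε`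
  have h2εt : 2 * (ε * t) ≤ 1 := by
    rw [hεt, ← div_eq_mul_one_div, div_le_one (by positivity)]
    nlinarith [hD1]
  have hexp : Real.exp (2 * (ε * t)) ≤ Real.exp 1 := Real.exp_le_exp.2 h2εt
  have h1t : 1 / t = 2 * ((Δ : ℝ) + 1) ^ 2 * ε := by rw [htdef, one_div_one_div]
  calc Real.exp (2 * (ε * t)) / t = Real.exp (2 * (ε * t)) * (1 / t) := div_eq_mul_one_div _ _
    _ ≤ Real.exp 1 * (1 / t) := mul_le_mul_of_nonneg_right hexp (by positivity)
    _ = 2 * Real.exp 1 * ((Δ : ℝ) + 1) ^ 2 * ε := by rw [h1t]; ring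

/-! ## §2. The convergent gas with the linear letter -/

section Measure

variable {Ω : Type*} {mΩ : MeasurableSpace Ω} {μ : Measure Ω} {𝓕 : V → MeasurableSpace Ω} {f : Finset V → Ω → ℂ} {ε : ℝ}

omit [DecidableEq V] [DecidableRel R] in
/-- The linear-letter smallness implies (357)'s admissibility `2(Δ+1)²ε ≤ 1`. [folklore] -/
theorem admissible_of_smallness (hε : 0 ≤ ε) (hsmall : Real.exp 1 * (2 * Real.exp 1 * ((Δ : ℝ) + 1) ^ 2 * ε) * ((Δ : ℝ) + 1) ^ 2 ≤ 1 / 2) :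
    2 * ((Δ : ℝ) + 1) ^ 2 * ε ≤ 1 := by
  have hD1 : 1 ≤ ((Δ : ℝ) + 1) ^ 2 := by
    have : (0 : ℝ) ≤ Δ := Nat.cast_nonneg Δ
    nlinarith
  have he : 1 ≤ Real.exp 1 := Real.one_le_exp zero_le_one
  have h0 : 0 ≤ 2 * ((Δ : ℝ) + 1) ^ 2 * ε := by positivity
  -- `x ≤ e·(e·x)·(Δ+1)² ≤ 1/2 ≤ 1`
  have h1 : 2 * ((Δ : ℝ) + 1) ^ 2 * ε ≤ Real.exp 1 * (2 * Real.exp 1 * ((Δ : ℝ) + 1) ^ 2 * ε) * ((Δ : ℝ) + 1) ^ 2 := by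
    have h2 : 2 * ((Δ : ℝ) + 1) ^ 2 * ε ≤ 2 * Real.exp 1 * ((Δ : ℝ) + 1) ^ 2 * ε := by nlinarith
    calc 2 * ((Δ : ℝ) + 1) ^ 2 * ε ≤ 2 * Real.exp 1 * ((Δ : ℝ) + 1) ^ 2 * ε := h2
      _ ≤ Real.exp 1 * (2 * Real.exp 1 * ((Δ : ℝ) + 1) ^ 2 * ε) := le_mul_of_one_le_left (by positivity) he
      _ ≤ Real.exp 1 * (2 * Real.exp 1 * ((Δ : ℝ) + 1) ^ 2 * ε) * ((Δ : ℝ) + 1) ^ 2 := le_mul_of_one_le_right (by positivity) hD1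
  linarith

/-- **ZERO-FREENESS WITH THE LINEAR LETTER**: `R` symmetric with `≤ Δ` neighbours, cell σ-algebras `𝓕_p ≤ mΩ` independent across non-touching
cell sets, set factors measurable in `⨆_{p∈X}𝓕_p` with integrable products, members of `𝒳` `R`-connected, `0 < ε`, `|M(𝒜)| ≤ ∏ε^{#X}` on `𝒜 ⊆ 𝒳`,
`e·ε₁·(Δ+1)² ≤ 1∕2` with `ε₁ = 2e(Δ+1)²ε` ⟹ `∫∏_{X∈𝒳}(1 + f_X)dμ ≠ 0`. [folklore] -/
theorem setPertZ_ne_zero_linear [IsProbabilityMeasure μ] (hR : ∀ x y, R x y → R y x) (hΔ : ∀ x, (nbr x).card ≤ Δ)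
    (hnbr : ∀ x y, R x y → y ∈ nbr x) (hle : ∀ p, 𝓕 p ≤ mΩ)
    (hindep : ∀ K₁ K₂ : Finset V, ¬ Touches R K₁ K₂ → Indep (⨆ p ∈ K₁, 𝓕 p) (⨆ p ∈ K₂, 𝓕 p) μ)
    (hmeas : ∀ X, Measurable[⨆ p ∈ X, 𝓕 p] (f X)) (hint : ∀ 𝒜 : Finset (Finset V), Integrable (fun ω => ∏ X ∈ 𝒜, f X ω) μ)
    (𝒳 : Finset (Finset V)) (hconn : ∀ X ∈ 𝒳, IsRConnected R X) (hε : 0 < ε)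
    (hM : ∀ 𝒜, 𝒜 ⊆ 𝒳 → ‖cellActivity μ f 𝒜‖ ≤ ∏ X ∈ 𝒜, ε ^ X.card)
    (hsmall : Real.exp 1 * (2 * Real.exp 1 * ((Δ : ℝ) + 1) ^ 2 * ε) * ((Δ : ℝ) + 1) ^ 2 ≤ 1 / 2) : pertZ μ f 𝒳 ≠ 0 := by
  rw [setPertZ_eq_resummedGas hR hle hindep hmeas hint 𝒳 hconn]
  exact SupPolymerActivityExpansion.ne_zero hR hΔ hnbr (pushforward_eq_zero_of_not_rconn 𝒳 hconn _)
    (abs_pushforwardActivity_le_linear hR hΔ hnbr 𝒳 hconn hε (admissible_of_smallness hε.le hsmall) hM) (by positivity) hsmall _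

/-- **THE KP LOGARITHM WITH THE LINEAR LETTER**: `exp(log Ξ(L; ⋃_*M)) = ∫∏_{X∈𝒳}(1 + f_X)dμ`. [folklore] -/
theorem exp_setLogZ_linear [IsProbabilityMeasure μ] (hR : ∀ x y, R x y → R y x) (hΔ : ∀ x, (nbr x).card ≤ Δ)
    (hnbr : ∀ x y, R x y → y ∈ nbr x) (hle : ∀ p, 𝓕 p ≤ mΩ)
    (hindep : ∀ K₁ K₂ : Finset V, ¬ Touches R K₁ K₂ → Indep (⨆ p ∈ K₁, 𝓕 p) (⨆ p ∈ K₂, 𝓕 p) μ)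
    (hmeas : ∀ X, Measurable[⨆ p ∈ X, 𝓕 p] (f X)) (hint : ∀ 𝒜 : Finset (Finset V), Integrable (fun ω => ∏ X ∈ 𝒜, f X ω) μ)
    (𝒳 : Finset (Finset V)) (hconn : ∀ X ∈ 𝒳, IsRConnected R X) (hε : 0 < ε)
    (hM : ∀ 𝒜, 𝒜 ⊆ 𝒳 → ‖cellActivity μ f 𝒜‖ ≤ ∏ X ∈ 𝒜, ε ^ X.card)
    (hsmall : Real.exp 1 * (2 * Real.exp 1 * ((Δ : ℝ) + 1) ^ 2 * ε) * ((Δ : ℝ) + 1) ^ 2 ≤ 1 / 2) :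
    Complex.exp (polymerLogZ (GeomInc R)
        (pushforwardActivity (fun 𝒜 : Finset (Finset V) => 𝒜.biUnion id) (cellActivity μ f) (rconnSubsets (Touches R) 𝒳))
        ((rconnSubsets (Touches R) 𝒳).image fun 𝒜 => 𝒜.biUnion id)) = pertZ μ f 𝒳 := by
  haveI : Std.Symm R := ⟨hR⟩
  rw [setPertZ_eq_resummedGas hR hle hindep hmeas hint 𝒳 hconn]
  exact SupPolymerActivityExpansion.exp_polymerLogZ hΔ hnbr (pushforward_eq_zero_of_not_rconn 𝒳 hconn _)
    (abs_pushforwardActivity_le_linear hR hΔ hnbr 𝒳 hconn hε (admissible_of_smallness hε.le hsmall) hM) (by positivity) hsmall _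

/-- **EXTENSIVITY WITH THE LINEAR LETTER**: `‖log Ξ(L; ⋃_*M)‖ ≤ #(⋃𝒳)·(Δ+1)·2e·ε₁`, `ε₁ = 2e(Δ+1)²ε` (the activity letter alone). [folklore] -/
theorem norm_setLogZ_le_linear (hR : ∀ x y, R x y → R y x) (hΔ : ∀ x, (nbr x).card ≤ Δ) (hnbr : ∀ x y, R x y → y ∈ nbr x)
    (𝒳 : Finset (Finset V)) (hconn : ∀ X ∈ 𝒳, IsRConnected R X) (hε : 0 < ε)
    (hM : ∀ 𝒜, 𝒜 ⊆ 𝒳 → ‖cellActivity μ f 𝒜‖ ≤ ∏ X ∈ 𝒜, ε ^ X.card)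
    (hsmall : Real.exp 1 * (2 * Real.exp 1 * ((Δ : ℝ) + 1) ^ 2 * ε) * ((Δ : ℝ) + 1) ^ 2 ≤ 1 / 2) :
    ‖polymerLogZ (GeomInc R)
        (pushforwardActivity (fun 𝒜 : Finset (Finset V) => 𝒜.biUnion id) (cellActivity μ f) (rconnSubsets (Touches R) 𝒳))
        ((rconnSubsets (Touches R) 𝒳).image fun 𝒜 => 𝒜.biUnion id)‖ ≤
      (𝒳.biUnion id).card * ((Δ : ℝ) + 1) * (2 * (Real.exp 1 * (2 * Real.exp 1 * ((Δ : ℝ) + 1) ^ 2 * ε))) :=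
  SupPolymerActivityExpansion.norm_polymerLogZ_le hR hΔ hnbr (pushforward_eq_zero_of_not_rconn 𝒳 hconn _)
    (abs_pushforwardActivity_le_linear hR hΔ hnbr 𝒳 hconn hε (admissible_of_smallness hε.le hsmall) hM) (by positivity) hsmall
    (image_biUnion_subset_rconn 𝒳 hconn)

end Measure

/-! ## §3. Toy -/

omit [DecidableRel R] in
/-- Toy (§1): for the EMPTY cover of `∅` the weighted bound reads `1 ≤ (1∕t)^0·1`. -/
example {ε t : ℝ} (hε : 0 ≤ ε) (ht : 1 ≤ t) :
    ∏ X ∈ (∅ : Finset (Finset V)), ε ^ X.card ≤ (1 / t) ^ (∅ : Finset V).card * ∏ X ∈ (∅ : Finset (Finset V)), (ε * t) ^ X.card :=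
  pow_totalsize_le_weighted hε ht (by simp)

end Summit.QuantumFields.BalabanUV.T4Continuum.NE7b.SupPolymerLocalSmallnessLinear
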